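import Summits.Ventures.CertifiedManyBodySolver.Downfold.EmeryShapeWindowClosure
import Summits.Ventures.CertifiedManyBodySolver.Downfold.EmeryScaleLeverSteps
import Summits.Ventures.CertifiedManyBodySolver.Downfold.EmeryFermiEnergyOf
import Summits.Ventures.CertifiedManyBodySolver.Downfold.EmeryFermiScalePointsLa214ALLPathRX0
import Summits.Ventures.CertifiedManyBodySolver.Downfold.EmeryFermiScalePointsLa214ALLPathTX0
import HarnessLib

/-!
# THE WIDTH BUDGET OF OBJECT E ON THE TYPED 3BE BOX `emeryBoxLa214v123`, x = 0 (ν = 1/2) (INFL-3to1-B §B.89 (b); router/OBJECT-E-BUDGET.tsv): certified point windows of the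
# one-band `t′/t` and `t_node` at the five corners of the true-corner PATHS, so that each whole-box window width telescopes into ONE CONTRIBUTION PER COORDINATE

Venture CertifiedManyBodySolver, cell `pub/hubbard-downfold` (stage S1), seat hubbard-downfold-mod-4 (technique B, g37); namespace
`Summit.Ventures.CertifiedManyBodySolver.Downfold.Emery`. Everything PROVED (0 sorry). WHAT THIS IS NOT: a statement about La₂₋ₓSrₓCuO₄ box #18 — whole Δ_pd hull [1.7, 4.0] (reference; = EmeryBoxesLa214TrueCorners) — the box is SCREENING-GRADE;
`U = 0` one-body kinematics of the σ model (d–pₓ–p_y + t_pp + t_pp′); «provenance per coordinate» of the one-band image, not a box edit.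

By the TRUE-CORNER RULES the whole-box windows are R ∈ [R(Δ₁,a₁,b₂,c₂), R(Δ₂,a₂,b₁,c₁)] (§B.87, `EmeryShapeTrueCornerRule`) and t ∈ [t(Δ₂,a₁,b₁,c₂), t(Δ₁,a₂,b₂,c₁)] (§B.88,
`EmeryScaleBoxRuleCells`); moving ONE coordinate at a time from the floor corner to the ceiling corner, the width is the telescoping sum of four signed one-coordinate
moves, each certified here as the difference of two point windows (K = 384 Fermi-energy brackets `EmeryFermiScalePointsLa214ALLPath{R,T}X0`; R window by the energy
monotonicity of `fsRatio` under the sign of `dopingDisc` (`EmeryShapeWindowClosure`), t window by `scaleNode_div_antitone` (`EmeryScaleLeverSteps`)). The path is the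
true-corner order; another order re-distributes the interaction terms but not the total.

R = t′/t path (x = 0 (ν = 1/2)):
| step (coordinate moved) | corner reached | certified point window | contribution to the width (certified interval; midpoint) |
|---|---|---|---|
| start | (Δ₁, a₁, b₂, c₂) = floor corner of R | [-0.2916, -0.2914] | — |
| Δ_pd | (Δ₂, a₁, b₂, c₂) = after the Δ move | [-0.2269, -0.2268] | [+0.0645, +0.0648]; +0.0646  |
| t_pd | (Δ₂, a₂, b₂, c₂) = after the t_pd move | [-0.2158, -0.2157] | [+0.0110, +0.0112]; +0.0111  |
| t_pp | (Δ₂, a₂, b₁, c₂) = after the t_pp move | [-0.1749, -0.1748] | [+0.0408, +0.0410]; +0.0409  |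
| t_pp′ | (Δ₂, a₂, b₁, c₁) = ceiling corner of R (after the t_pp′ move) | [-0.1676, -0.1674] | [+0.0072, +0.0075]; +0.0073  |
TOTAL R width (ceiling − floor, certified interval): [0.1238, 0.1242].

t = t_node path (x = 0 (ν = 1/2), eV):
| step (coordinate moved) | corner reached | certified point window | contribution to the width (certified interval; midpoint) |
|---|---|---|---|
| start | (Δ₂, a₁, b₁, c₂) = floor corner of t | [0.3248, 0.3264] | — |
| Δ_pd | (Δ₁, a₁, b₁, c₂) = after the Δ move | [0.4275, 0.4302] | [+0.1011, +0.1054]; +0.1032 eV |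
| t_pd | (Δ₁, a₂, b₁, c₂) = after the t_pd move | [0.4909, 0.4947] | [+0.0607, +0.0672]; +0.0640 eV |
| t_pp | (Δ₁, a₂, b₂, c₂) = after the t_pp move | [0.5655, 0.5696] | [+0.0708, +0.0787]; +0.0747 eV |
| t_pp′ | (Δ₁, a₂, b₂, c₁) = ceiling corner of t (after the t_pp′ move) | [0.5705, 0.5744] | [+0.0009, +0.0089]; +0.0049 eV |
TOTAL t width (certified interval): [0.2441, 0.2496] eV.

Sources: three-band model [HybertsenSchluterChristensen1989, Eq. (1)]; energy-linearised one-band image [AndersenEtAl1995, §6].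
-/

noncomputable section

namespace Summit.Ventures.CertifiedManyBodySolver.Downfold.Emery

open Real Set

/-- **R-path corner (Δ₁, a₁, b₂, c₂) = floor corner of R = (1.7, 1.29, 0.66, 0.15), x = 0 (ν = 1/2): the one-band Fermi-surface `t′/t` lies in `[-0.2916, -0.2914]`** (ε_F bracket + monotone energy window). [folklore] -/
theorem la214ALLPath_fsRatio_RF_x0 :
    fsRatio ((17 : ℝ) / 10) ((129 : ℝ) / 100) ((33 : ℝ) / 50) ((3 : ℝ) / 20) (fermiEnergyOf ((17 : ℝ) / 10) ((129 : ℝ) / 100) ((33 : ℝ) / 50) ((3 : ℝ) / 20) ((1 : ℝ) / 2)) ∈ Icc ((-729 : ℝ) / 2500) ((-1457 : ℝ) / 5000) := by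
  have hE := (fermiEnergyOf_of_pointBracketCheck pathPt_La214ALLRF_x0_br (by norm_num) (by norm_num) (by norm_num) (ν := (1/2 : ℝ)) (by push_cast; exact ⟨le_rfl, le_rfl⟩)).2
  push_cast at hE
  norm_num at hE
  have hw := fsRatio_mem_Icc_on_window_of_dopingDisc_nonpos (Δ := ((17 : ℝ) / 10)) (a := ((129 : ℝ) / 100)) (b := ((33 : ℝ) / 50)) (c := ((3 : ℝ) / 20)) (p := ((9769 : ℝ) / 5000)) (q := ((2461 : ℝ) / 1250))
    (by norm_num) (by norm_num) (by norm_num) (by norm_num) (by norm_num) (by norm_num) (by norm_num) (by norm_num [dopingDisc]) hE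
  constructor
  · refine le_trans ?_ hw.1
    norm_num [fsRatio, fsD, fsN]
  · refine le_trans hw.2 ?_
    norm_num [fsRatio, fsD, fsN]

/-- **R-path corner (Δ₂, a₁, b₂, c₂) = after the Δ move = (4, 1.29, 0.66, 0.15), x = 0 (ν = 1/2): the one-band Fermi-surface `t′/t` lies in `[-0.2269, -0.2268]`** (ε_F bracket + antitone energy window). [folklore] -/
theorem la214ALLPath_fsRatio_R1_x0 :
    fsRatio (4 : ℝ) ((129 : ℝ) / 100) ((33 : ℝ) / 50) ((3 : ℝ) / 20) (fermiEnergyOf (4 : ℝ) ((129 : ℝ) / 100) ((33 : ℝ) / 50) ((3 : ℝ) / 20) ((1 : ℝ) / 2)) ∈ Icc ((-2269 : ℝ) / 10000) ((-567 : ℝ) / 2500) := by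
  have hE := (fermiEnergyOf_of_pointBracketCheck pathPt_La214ALLR1_x0_br (by norm_num) (by norm_num) (by norm_num) (ν := (1/2 : ℝ)) (by push_cast; exact ⟨le_rfl, le_rfl⟩)).2
  push_cast at hE
  norm_num at hE
  have hw := fsRatio_mem_Icc_on_window_of_dopingDisc_nonneg (Δ := (4 : ℝ)) (a := ((129 : ℝ) / 100)) (b := ((33 : ℝ) / 50)) (c := ((3 : ℝ) / 20)) (p := ((1619 : ℝ) / 1250)) (q := ((3263 : ℝ) / 2500))
    (by norm_num) (by norm_num) (by norm_num) (by norm_num) (by norm_num) (by norm_num) (by norm_num) (by norm_num [dopingDisc]) hE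
  constructor
  · refine le_trans ?_ hw.1
    norm_num [fsRatio, fsD, fsN]
  · refine le_trans hw.2 ?_
    norm_num [fsRatio, fsD, fsN]

/-- **R-path corner (Δ₂, a₂, b₂, c₂) = after the t_pd move = (4, 1.52, 0.66, 0.15), x = 0 (ν = 1/2): the one-band Fermi-surface `t′/t` lies in `[-0.2158, -0.2157]`** (ε_F bracket + monotone energy window). [folklore] -/
theorem la214ALLPath_fsRatio_R2_x0 :
    fsRatio (4 : ℝ) ((38 : ℝ) / 25) ((33 : ℝ) / 50) ((3 : ℝ) / 20) (fermiEnergyOf (4 : ℝ) ((38 : ℝ) / 25) ((33 : ℝ) / 50) ((3 : ℝ) / 20) ((1 : ℝ) / 2)) ∈ Icc ((-1079 : ℝ) / 5000) ((-2157 : ℝ) / 10000) := by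
  have hE := (fermiEnergyOf_of_pointBracketCheck pathPt_La214ALLR2_x0_br (by norm_num) (by norm_num) (by norm_num) (ν := (1/2 : ℝ)) (by push_cast; exact ⟨le_rfl, le_rfl⟩)).2
  push_cast at hE
  norm_num at hE
  have hw := fsRatio_mem_Icc_on_window_of_dopingDisc_nonpos (Δ := (4 : ℝ)) (a := ((38 : ℝ) / 25)) (b := ((33 : ℝ) / 50)) (c := ((3 : ℝ) / 20)) (p := ((16701 : ℝ) / 10000)) (q := ((16851 : ℝ) / 10000))
    (by norm_num) (by norm_num) (by norm_num) (by norm_num) (by norm_num) (by norm_num) (by norm_num) (by norm_num [dopingDisc]) hE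
  constructor
  · refine le_trans ?_ hw.1
    norm_num [fsRatio, fsD, fsN]
  · refine le_trans hw.2 ?_
    norm_num [fsRatio, fsD, fsN]

/-- **R-path corner (Δ₂, a₂, b₁, c₂) = after the t_pp move = (4, 1.52, 0.46, 0.15), x = 0 (ν = 1/2): the one-band Fermi-surface `t′/t` lies in `[-0.1749, -0.1748]`** (ε_F bracket + monotone energy window). [folklore] -/
theorem la214ALLPath_fsRatio_R3_x0 :
    fsRatio (4 : ℝ) ((38 : ℝ) / 25) ((23 : ℝ) / 50) ((3 : ℝ) / 20) (fermiEnergyOf (4 : ℝ) ((38 : ℝ) / 25) ((23 : ℝ) / 50) ((3 : ℝ) / 20) ((1 : ℝ) / 2)) ∈ Icc ((-1749 : ℝ) / 10000) ((-437 : ℝ) / 2500) := by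
  have hE := (fermiEnergyOf_of_pointBracketCheck pathPt_La214ALLR3_x0_br (by norm_num) (by norm_num) (by norm_num) (ν := (1/2 : ℝ)) (by push_cast; exact ⟨le_rfl, le_rfl⟩)).2
  push_cast at hE
  norm_num at hE
  have hw := fsRatio_mem_Icc_on_window_of_dopingDisc_nonpos (Δ := (4 : ℝ)) (a := ((38 : ℝ) / 25)) (b := ((23 : ℝ) / 50)) (c := ((3 : ℝ) / 20)) (p := ((8097 : ℝ) / 5000)) (q := ((8147 : ℝ) / 5000))
    (by norm_num) (by norm_num) (by norm_num) (by norm_num) (by norm_num) (by norm_num) (by norm_num) (by norm_num [dopingDisc]) hE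
  constructor
  · refine le_trans ?_ hw.1
    norm_num [fsRatio, fsD, fsN]
  · refine le_trans hw.2 ?_
    norm_num [fsRatio, fsD, fsN]

/-- **R-path corner (Δ₂, a₂, b₁, c₁) = ceiling corner of R (after the t_pp′ move) = (4, 1.52, 0.46, 0.12), x = 0 (ν = 1/2): the one-band Fermi-surface `t′/t` lies in `[-0.1676, -0.1674]`** (ε_F bracket + monotone energy window). [folklore] -/
theorem la214ALLPath_fsRatio_RC_x0 :
    fsRatio (4 : ℝ) ((38 : ℝ) / 25) ((23 : ℝ) / 50) ((3 : ℝ) / 25) (fermiEnergyOf (4 : ℝ) ((38 : ℝ) / 25) ((23 : ℝ) / 50) ((3 : ℝ) / 25) ((1 : ℝ) / 2)) ∈ Icc ((-419 : ℝ) / 2500) ((-837 : ℝ) / 5000) := by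
  have hE := (fermiEnergyOf_of_pointBracketCheck pathPt_La214ALLRC_x0_br (by norm_num) (by norm_num) (by norm_num) (ν := (1/2 : ℝ)) (by push_cast; exact ⟨le_rfl, le_rfl⟩)).2
  push_cast at hE
  norm_num at hE
  have hw := fsRatio_mem_Icc_on_window_of_dopingDisc_nonpos (Δ := (4 : ℝ)) (a := ((38 : ℝ) / 25)) (b := ((23 : ℝ) / 50)) (c := ((3 : ℝ) / 25)) (p := ((2049 : ℝ) / 1250)) (q := ((4123 : ℝ) / 2500))
    (by norm_num) (by norm_num) (by norm_num) (by norm_num) (by norm_num) (by norm_num) (by norm_num) (by norm_num [dopingDisc]) hE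
  constructor
  · refine le_trans ?_ hw.1
    norm_num [fsRatio, fsD, fsN]
  · refine le_trans hw.2 ?_
    norm_num [fsRatio, fsD, fsN]

/-- **t-path corner (Δ₂, a₁, b₁, c₂) = floor corner of t = (4, 1.29, 0.46, 0.15), x = 0 (ν = 1/2): the velocity-matched one-band `t_node` lies in `[0.3248, 0.3264]` eV** (ε_F bracket; `t_node` antitone in ε). [folklore] -/
theorem la214ALLPath_scale_TF_x0 :
    scaleT (4 : ℝ) ((129 : ℝ) / 100) ((23 : ℝ) / 50) ((3 : ℝ) / 20) (xNode (4 : ℝ) ((129 : ℝ) / 100) ((23 : ℝ) / 50) ((3 : ℝ) / 20) (fermiEnergyOf (4 : ℝ) ((129 : ℝ) / 100) ((23 : ℝ) / 50) ((3 : ℝ) / 20) ((1 : ℝ) / 2))) (xNode (4 : ℝ) ((129 : ℝ) / 100) ((23 : ℝ) / 50) ((3 : ℝ) / 20) (fermiEnergyOf (4 : ℝ) ((129 : ℝ) / 100) ((23 : ℝ) / 50) ((3 : ℝ) / 20) ((1 : ℝ) / 2))) (fermiEnergyOf (4 : ℝ) ((129 : ℝ) / 100) ((23 : ℝ) / 50)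 ((3 : ℝ) / 20) ((1 : ℝ) / 2)) ∈ Icc ((203 : ℝ) / 625) ((204 : ℝ) / 625) := by
  have hE := (fermiEnergyOf_of_pointBracketCheck pathPt_La214ALLTF_x0_br (by norm_num) (by norm_num) (by norm_num) (ν := (1/2 : ℝ)) (by push_cast; exact ⟨le_rfl, le_rfl⟩)).2
  push_cast at hE
  norm_num at hE
  have hE0 : (0 : ℝ) ≤ fermiEnergyOf (4 : ℝ) ((129 : ℝ) / 100) ((23 : ℝ) / 50) ((3 : ℝ) / 20) ((1 : ℝ) / 2) := le_trans (by norm_num) hE.1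
  rw [scaleT_node_eq (by linarith) hE0 (by norm_num) (by norm_num) (by norm_num)]
  have h1 := scaleNode_div_antitone (Δ := (4 : ℝ)) (tpd := ((129 : ℝ) / 100)) (tpp := ((23 : ℝ) / 50)) (c := ((3 : ℝ) / 20)) (ε₁ := ((12489 : ℝ) / 10000)) (by norm_num) (by norm_num) (by norm_num) (by norm_num) (by norm_num) hE.1
    (by nlinarith [hE.2]) (by norm_num)
  have h2 := scaleNode_div_antitone (Δ := (4 : ℝ)) (tpd := ((129 : ℝ) / 100)) (tpp := ((23 : ℝ) / 50)) (c := ((3 : ℝ) / 20)) (ε₂ := ((12589 : ℝ) / 10000)) (by norm_num) (by norm_num) (by norm_num) (by norm_num) (lt_of_lt_of_le (by norm_num) hE.1) hE.2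
    (by norm_num) (by norm_num)
  constructor
  · refine le_trans ?_ h2
    rw [le_div_iff₀ (by norm_num [scaleNodeD])]
    norm_num [scaleNodeN, scaleNodeD, fsT, fsD, fsN]
  · refine le_trans h1 ?_
    rw [div_le_iff₀ (by norm_num [scaleNodeD])]
    norm_num [scaleNodeN, scaleNodeD, fsT, fsD, fsN]

/-- **t-path corner (Δ₁, a₁, b₁, c₂) = after the Δ move = (1.7, 1.29, 0.46, 0.15), x = 0 (ν = 1/2): the velocity-matched one-band `t_node` lies in `[0.4275, 0.4302]` eV** (ε_F bracket; `t_node` antitone in ε). [folklore] -/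
theorem la214ALLPath_scale_T1_x0 :
    scaleT ((17 : ℝ) / 10) ((129 : ℝ) / 100) ((23 : ℝ) / 50) ((3 : ℝ) / 20) (xNode ((17 : ℝ) / 10) ((129 : ℝ) / 100) ((23 : ℝ) / 50) ((3 : ℝ) / 20) (fermiEnergyOf ((17 : ℝ) / 10) ((129 : ℝ) / 100) ((23 : ℝ) / 50) ((3 : ℝ) / 20) ((1 : ℝ) / 2))) (xNode ((17 : ℝ) / 10) ((129 : ℝ) / 100) ((23 : ℝ) / 50) ((3 : ℝ) / 20) (fermiEnergyOf ((17 : ℝ) / 10) ((129 : ℝ) / 100) ((23 : ℝ) / 50) ((3 : ℝ) / 20) ((1 : ℝ) / 2))) (fermiEnergyOf ((17 : ℝ) / 10) ((129 : ℝ) / 100) ((23 : ℝ) / 50) ((3 : ℝ) / 20) ((1 : ℝ) / 2)) ∈ Icc ((171 : ℝ) / 400) ((2151 : ℝ) / 5000) := by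
  have hE := (fermiEnergyOf_of_pointBracketCheck pathPt_La214ALLT1_x0_br (by norm_num) (by norm_num) (by norm_num) (ν := (1/2 : ℝ)) (by push_cast; exact ⟨le_rfl, le_rfl⟩)).2
  push_cast at hE
  norm_num at hE
  have hE0 : (0 : ℝ) ≤ fermiEnergyOf ((17 : ℝ) / 10) ((129 : ℝ) / 100) ((23 : ℝ) / 50) ((3 : ℝ) / 20) ((1 : ℝ) / 2) := le_trans (by norm_num) hE.1
  rw [scaleT_node_eq (by linarith) hE0 (by norm_num) (by norm_num) (by norm_num)]
  have h1 := scaleNode_div_antitone (Δ := ((17 : ℝ) / 10)) (tpd := ((129 : ℝ) / 100)) (tpp := ((23 : ℝ) / 50)) (c := ((3 : ℝ) / 20)) (ε₁ := ((18641 : ℝ) / 10000)) (by norm_num) (by norm_num) (by norm_num) (by norm_num) (by norm_num) hE.1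
    (by nlinarith [hE.2]) (by norm_num)
  have h2 := scaleNode_div_antitone (Δ := ((17 : ℝ) / 10)) (tpd := ((129 : ℝ) / 100)) (tpp := ((23 : ℝ) / 50)) (c := ((3 : ℝ) / 20)) (ε₂ := ((18741 : ℝ) / 10000)) (by norm_num) (by norm_num) (by norm_num) (by norm_num) (lt_of_lt_of_le (by norm_num) hE.1) hE.2
    (by norm_num) (by norm_num)
  constructor
  · refine le_trans ?_ h2
    rw [le_div_iff₀ (by norm_num [scaleNodeD])]
    norm_num [scaleNodeN, scaleNodeD, fsT, fsD, fsN]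
  · refine le_trans h1 ?_
    rw [div_le_iff₀ (by norm_num [scaleNodeD])]
    norm_num [scaleNodeN, scaleNodeD, fsT, fsD, fsN]

/-- **t-path corner (Δ₁, a₂, b₁, c₂) = after the t_pd move = (1.7, 1.52, 0.46, 0.15), x = 0 (ν = 1/2): the velocity-matched one-band `t_node` lies in `[0.4909, 0.4947]` eV** (ε_F bracket; `t_node` antitone in ε). [folklore] -/
theorem la214ALLPath_scale_T2_x0 :
    scaleT ((17 : ℝ) / 10) ((38 : ℝ) / 25) ((23 : ℝ) / 50) ((3 : ℝ) / 20) (xNode ((17 : ℝ) / 10) ((38 : ℝ) / 25) ((23 : ℝ) / 50) ((3 : ℝ) / 20) (fermiEnergyOf ((17 : ℝ) / 10) ((38 : ℝ) / 25) ((23 : ℝ) / 50) ((3 : ℝ) / 20) ((1 : ℝ) / 2))) (xNode ((17 : ℝ) / 10) ((38 : ℝ) / 25) ((23 : ℝ) / 50) ((3 : ℝ) / 20) (fermiEnergyOf ((17 : ℝ) / 10) ((38 : ℝ) / 25) ((23 : ℝ) / 50) ((3 : ℝ) / 20) ((1 : ℝ) / 2))) (fermiEnergyOf ((17 : ℝ)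 / 10) ((38 : ℝ) / 25) ((23 : ℝ) / 50) ((3 : ℝ) / 20) ((1 : ℝ) / 2)) ∈ Icc ((4909 : ℝ) / 10000) ((4947 : ℝ) / 10000) := by
  have hE := (fermiEnergyOf_of_pointBracketCheck pathPt_La214ALLT2_x0_br (by norm_num) (by norm_num) (by norm_num) (ν := (1/2 : ℝ)) (by push_cast; exact ⟨le_rfl, le_rfl⟩)).2
  push_cast at hE
  norm_num at hE
  have hE0 : (0 : ℝ) ≤ fermiEnergyOf ((17 : ℝ) / 10) ((38 : ℝ) / 25) ((23 : ℝ) / 50) ((3 : ℝ) / 20) ((1 : ℝ) / 2) := le_trans (by norm_num) hE.1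
  rw [scaleT_node_eq (by linarith) hE0 (by norm_num) (by norm_num) (by norm_num)]
  have h1 := scaleNode_div_antitone (Δ := ((17 : ℝ) / 10)) (tpd := ((38 : ℝ) / 25)) (tpp := ((23 : ℝ) / 50)) (c := ((3 : ℝ) / 20)) (ε₁ := ((4589 : ℝ) / 2000)) (by norm_num) (by norm_num) (by norm_num) (by norm_num) (by norm_num) hE.1
    (by nlinarith [hE.2]) (by norm_num)
  have h2 := scaleNode_div_antitone (Δ := ((17 : ℝ) / 10)) (tpd := ((38 : ℝ) / 25)) (tpp := ((23 : ℝ) / 50)) (c := ((3 : ℝ) / 20)) (ε₂ := ((4619 : ℝ) / 2000)) (by norm_num) (by norm_num) (by norm_num) (by norm_num) (lt_of_lt_of_le (by norm_num) hE.1) hE.2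
    (by norm_num) (by norm_num)
  constructor
  · refine le_trans ?_ h2
    rw [le_div_iff₀ (by norm_num [scaleNodeD])]
    norm_num [scaleNodeN, scaleNodeD, fsT, fsD, fsN]
  · refine le_trans h1 ?_
    rw [div_le_iff₀ (by norm_num [scaleNodeD])]
    norm_num [scaleNodeN, scaleNodeD, fsT, fsD, fsN]

/-- **t-path corner (Δ₁, a₂, b₂, c₂) = after the t_pp move = (1.7, 1.52, 0.66, 0.15), x = 0 (ν = 1/2): the velocity-matched one-band `t_node` lies in `[0.5655, 0.5696]` eV** (ε_F bracket; `t_node` antitone in ε). [folklore] -/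
theorem la214ALLPath_scale_T3_x0 :
    scaleT ((17 : ℝ) / 10) ((38 : ℝ) / 25) ((33 : ℝ) / 50) ((3 : ℝ) / 20) (xNode ((17 : ℝ) / 10) ((38 : ℝ) / 25) ((33 : ℝ) / 50) ((3 : ℝ) / 20) (fermiEnergyOf ((17 : ℝ) / 10) ((38 : ℝ) / 25) ((33 : ℝ) / 50) ((3 : ℝ) / 20) ((1 : ℝ) / 2))) (xNode ((17 : ℝ) / 10) ((38 : ℝ) / 25) ((33 : ℝ) / 50) ((3 : ℝ) / 20) (fermiEnergyOf ((17 : ℝ) / 10) ((38 : ℝ) / 25) ((33 : ℝ) / 50) ((3 : ℝ) / 20) ((1 : ℝ) / 2))) (fermiEnergyOf ((17 : ℝ) / 10) ((38 : ℝ) / 25) ((33 : ℝ) / 50) ((3 : ℝ) / 20) ((1 : ℝ) / 2)) ∈ Icc ((1131 : ℝ) / 2000) ((356 : ℝ) / 625) := by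
  have hE := (fermiEnergyOf_of_pointBracketCheck pathPt_La214ALLT3_x0_br (by norm_num) (by norm_num) (by norm_num) (ν := (1/2 : ℝ)) (by push_cast; exact ⟨le_rfl, le_rfl⟩)).2
  push_cast at hE
  norm_num at hE
  have hE0 : (0 : ℝ) ≤ fermiEnergyOf ((17 : ℝ) / 10) ((38 : ℝ) / 25) ((33 : ℝ) / 50) ((3 : ℝ) / 20) ((1 : ℝ) / 2) := le_trans (by norm_num) hE.1
  rw [scaleT_node_eq (by linarith) hE0 (by norm_num) (by norm_num) (by norm_num)]
  have h1 := scaleNode_div_antitone (Δ := ((17 : ℝ) / 10)) (tpd := ((38 : ℝ) / 25)) (tpp := ((33 : ℝ) / 50)) (c := ((3 : ℝ) / 20)) (ε₁ := ((23891 : ℝ) / 10000)) (by norm_num) (by norm_num) (by norm_num) (by norm_num) (by norm_num) hE.1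
    (by nlinarith [hE.2]) (by norm_num)
  have h2 := scaleNode_div_antitone (Δ := ((17 : ℝ) / 10)) (tpd := ((38 : ℝ) / 25)) (tpp := ((33 : ℝ) / 50)) (c := ((3 : ℝ) / 20)) (ε₂ := ((24041 : ℝ) / 10000)) (by norm_num) (by norm_num) (by norm_num) (by norm_num) (lt_of_lt_of_le (by norm_num) hE.1) hE.2
    (by norm_num) (by norm_num)
  constructor
  · refine le_trans ?_ h2
    rw [le_div_iff₀ (by norm_num [scaleNodeD])]
    norm_num [scaleNodeN, scaleNodeD, fsT, fsD, fsN]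
  · refine le_trans h1 ?_
    rw [div_le_iff₀ (by norm_num [scaleNodeD])]
    norm_num [scaleNodeN, scaleNodeD, fsT, fsD, fsN]

/-- **t-path corner (Δ₁, a₂, b₂, c₁) = ceiling corner of t (after the t_pp′ move) = (1.7, 1.52, 0.66, 0.12), x = 0 (ν = 1/2): the velocity-matched one-band `t_node` lies in `[0.5705, 0.5744]` eV** (ε_F bracket; `t_node` antitone in ε). [folklore] -/
theorem la214ALLPath_scale_TC_x0 :
    scaleT ((17 : ℝ) / 10) ((38 : ℝ) / 25) ((33 : ℝ) / 50) ((3 : ℝ) / 25) (xNode ((17 : ℝ) / 10) ((38 : ℝ) / 25) ((33 : ℝ) / 50) ((3 : ℝ) / 25) (fermiEnergyOf ((17 : ℝ) / 10) ((38 : ℝ) / 25) ((33 : ℝ) / 50) ((3 : ℝ) / 25) ((1 : ℝ) / 2))) (xNode ((17 : ℝ) / 10) ((38 : ℝ) / 25) ((33 : ℝ) / 50) ((3 : ℝ) / 25) (fermiEnergyOf ((17 : ℝ) / 10) ((38 : ℝ) / 25) ((33 : ℝ) / 50) ((3 : ℝ) / 25) ((1 : ℝ) / 2))) (fermiEnergyOf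 ((17 : ℝ) / 10) ((38 : ℝ) / 25) ((33 : ℝ) / 50) ((3 : ℝ) / 25) ((1 : ℝ) / 2)) ∈ Icc ((1141 : ℝ) / 2000) ((359 : ℝ) / 625) := by
  have hE := (fermiEnergyOf_of_pointBracketCheck pathPt_La214ALLTC_x0_br (by norm_num) (by norm_num) (by norm_num) (ν := (1/2 : ℝ)) (by push_cast; exact ⟨le_rfl, le_rfl⟩)).2
  push_cast at hE
  norm_num at hE
  have hE0 : (0 : ℝ) ≤ fermiEnergyOf ((17 : ℝ) / 10) ((38 : ℝ) / 25) ((33 : ℝ) / 50) ((3 : ℝ) / 25) ((1 : ℝ) / 2) := le_trans (by norm_num) hE.1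
  rw [scaleT_node_eq (by linarith) hE0 (by norm_num) (by norm_num) (by norm_num)]
  have h1 := scaleNode_div_antitone (Δ := ((17 : ℝ) / 10)) (tpd := ((38 : ℝ) / 25)) (tpp := ((33 : ℝ) / 50)) (c := ((3 : ℝ) / 25)) (ε₁ := ((12099 : ℝ) / 5000)) (by norm_num) (by norm_num) (by norm_num) (by norm_num) (by norm_num) hE.1
    (by nlinarith [hE.2]) (by norm_num)
  have h2 := scaleNode_div_antitone (Δ := ((17 : ℝ) / 10)) (tpd := ((38 : ℝ) / 25)) (tpp := ((33 : ℝ) / 50)) (c := ((3 : ℝ) / 25)) (ε₂ := ((6087 : ℝ) / 2500)) (by norm_num) (by norm_num) (by norm_num) (by norm_num) (lt_of_lt_of_le (by norm_num) hE.1) hE.2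
    (by norm_num) (by norm_num)
  constructor
  · refine le_trans ?_ h2
    rw [le_div_iff₀ (by norm_num [scaleNodeD])]
    norm_num [scaleNodeN, scaleNodeD, fsT, fsD, fsN]
  · refine le_trans h1 ?_
    rw [div_le_iff₀ (by norm_num [scaleNodeD])]
    norm_num [scaleNodeN, scaleNodeD, fsT, fsD, fsN]

end Summit.Ventures.CertifiedManyBodySolver.Downfold.Emery
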